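/-
Copyright (c) 2026 the pub-hodgecm-mathlib formalisation cell (harness21).  R90-TF SLAB, section S10 (Rogawski 1990, §13.8 Prop. 13.8.3 read at `v`),
prover R90-C138-p03 (g2) — DEAL #13 (g2): junction J-6b glue (i), the arch–fin FACTORISATION of the frozen test function `𝔳.ΦG φ = f_∞ ⊗ Λ_φ`;
h413 = `stmt-HodgeConjecture-24833`, route `HCCMUnconditional`.
-/
import Summits.HodgeConjecture.HodgeConjecture.Theorems.R90S10MemberFinModelDefs     -- ★ p863660: `memberFinAdelicEquiv 𝔳` (the transport `ẽ`) + PIN `memberFinAdelicEquiv_apply`; ★ C2 carriers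
import Summits.HodgeConjecture.HodgeConjecture.Theorems.R90S10FrozenVectorKit        -- ★ p863261: `finprod_subtype_indicator_eq_ite` (box indicator = unit `finprod`)
import Literature.NumberTheory.Automorphic.UnitaryGroupPureTensorContinuity            -- ★ `localPiEquiv_evalPlace_finPart`, `toLocal_mem_localIntegralLevel_iff`
import Literature.NumberTheory.Automorphic.RestrictedTensorProductTraceProduct         -- ★ `isLevel_boxSubgroup_restrictedPureTensor`, ★ `boxSubgroup` kit (`RestrictedProductBoxes`)
import Literature.NumberTheory.Automorphic.CMPrincipalSeriesJacquetEvalOne             -- ★ `nonarchimedeanGroup_unitaryGroupOfForm_local`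
import HarnessLib

/-!
# R90-TF ∕ S10 — junction J-6b, glue (i): `𝔳.ΦG φ (x) = f_∞(x_∞) · Λ_φ(x_f)` with `Λ_φ` EXPLICIT on `U(Φ₃)(𝔸_{L⁺,f})`
# (`Theorems/R90S10PhiGArchFinFactorisation.lean`; ns `Summit.HodgeConjecture.HodgeConjecture.R90.S10`; DEAL #13 of R90-C138-plan (g2), 2026-09-05)

Cell `hodgecm-mathlib`, crux H413 (`stmt-HodgeConjecture-24833`), route of record `HCCMUnconditional`; programme R90-TF, section S10 (base `R90-C138`).
DEFINITION lane (two data `def`s + read-backs; no Prop-valued def, no instance, no notation, no `sorry`; imports ★ only, law L9).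

WHY.  Card 6b's ★ letter `ArchFinSplitG3Letter L` (p863626) splits the class trace of a discrete constituent `P` of `L²([U(Φ₃)])` on every test function
`F ∈ C_c(U(Φ₃)(𝔸))` that FACTORISES as `F(x) = f_∞(x_∞) · Λ(x_f)` with `f_∞ ∈ C_c^∞(G_∞)` and `Λ ∈ C_c^∞(U(Φ₃)(𝔸_f))` (★ `IsLocSmooth`).  The consumer — the field
`hsplit` of ★ `S10MemberFlath … 𝔥 𝔳 μG νG c πc` (card 6, `memberFlath_of_archData`, R90-C138-p02) — reads the split at the FROZEN test function `F := 𝔳.ΦG φ` of ★ C2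
`S10Frozen` («`f = f_∞ ⊗ φ ⊗ 𝟙_{K^v}`», pinned pointwise by ★ `S10Frozen.hΦG`) and at the finite model on `Πʳ_w [U(Φ₃)(L⁺_w), K_w]` transported along ★ `memberFinAdelicEquiv 𝔳 =: ẽ`.
This file supplies the two hypotheses of the letter at that instance, BY NAME:
* `S10Frozen.finLevelFun 𝔳 φ` — the integrand of `hsplit` VERBATIM, `g ↦ φ(g_v) · 𝟙{∀ w ≠ v, g_w ∈ K_w}` on `Πʳ_w [U(Φ₃)(L⁺_w), K_w]`;
* `S10Frozen.finAdelicFun 𝔳 φ := finLevelFun ∘ ẽ` — the finite part `Λ_φ` READ ON `U(Φ₃)(𝔸_{L⁺,f})` (explicit; composes with ★ `smoothTrace_comp_continuousMulEquiv` by `rfl`);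
* `memberFinAdelicEquiv_finPart_apply` — the coordinate pin `(ẽ x_f)_w = x_w` (★ `memberFinAdelicEquiv_apply` + ★ `localPiEquiv_evalPlace_finPart`);
* **`S10Frozen.ΦG_eq_fGi_mul_finAdelicFun`** — `𝔳.ΦG φ x = 𝔳.fGi (x_∞) · Λ_φ (x_f)` for locally smooth `φ` (★ `hΦG` + the unit `finprod` = box indicator, ★ `finprod_subtype_indicator_eq_ite`);
* `isLevel_boxSubgroup_finLevelFun` — the `K^v`-BI-INVARIANCE read-back: `K₀ × ∏_{w ≠ v} K_w` is a level of `finLevelFun` for every level `K₀ ≤ K_v` of `φ`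
  (★ `isLevel_boxSubgroup_restrictedPureTensor`), whence `isLocSmooth_finLevelFun`, `isLocSmooth_finAdelicFun` (= the letter's guard `IsLocSmooth Λ`).
«`f = f_u × f_{v′} × f^{u,v′}`», «`f^∞ = Π f_v`» [Rogawski1990, §13.8 p. 218 L24, p. 219 L1–L3]; `G(𝔸) = G_∞ × G(𝔸_f)` [BorelJacquet1979, §4.1]; the compact open
boxes `K′_S × K^S` [FlathCorvallis1979, §2 Example 2].
HONEST LABEL: coordinate bookkeeping; closes no socket; HC_CM is proved only modulo the 7 printed citations (2 remaining named inputs: hLiu418 = `stmt-HodgeConjecture-24832`,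
h413 = `stmt-HodgeConjecture-24833`) until rung 0 closes; REL ≠ ★ ≠ BUILT; count-neutral.

## References
* [Rogawski1990] J. D. Rogawski, *Automorphic Representations of Unitary Groups in Three Variables*, Ann. of Math. Stud. 123 (1990), §13.8 pp. 218–219.
* [BorelJacquet1979] A. Borel, H. Jacquet, *Automorphic forms and automorphic representations*, PSPM 33.1 (1979), §4.1.
* [FlathCorvallis1979] D. Flath, *Decomposition of representations into tensor products*, PSPM 33.1 (1979), §2 Example 2.
* [PlatonovRapinchuk1994] V. Platonov, A. Rapinchuk, *Algebraic Groups and Number Theory* (1994), §5.1.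
-/

set_option autoImplicit false
set_option linter.dupNamespace false

noncomputable section

open scoped RestrictedProduct Matrix MatrixGroups
open Filter MeasureTheory NumberField IsDedekindDomain CompactlySupported
open Literature.NumberTheory.Rogawski1990 Literature.NumberTheory.Automorphic Literature.NumberTheory.Automorphic.UnitaryGroup
open Literature.NumberTheory.Automorphic.UnitaryGroup.CotangentForms Literature.NumberTheory.GaloisRepresentations
open Literature.NumberTheory.Automorphic.Arthur2013.Leaves.TECR
open Summit.HodgeConjecture.HodgeConjecture.Cruxes.H413
open Summit.HodgeConjecture.HodgeConjecture.Cruxes.H413.K2E1TraceFormulaBeta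
open Summit.HodgeConjecture.HodgeConjecture.Cruxes.H413.K2E1SpectralTermsDiscreteHalf

namespace Summit.HodgeConjecture.HodgeConjecture.R90.S10

section Glue

variable {L : Type} [Field L] [NumberField L] [IsCMField L] [DecidableEq (Pl L)] {μ : HeckeCharacter L} {v : Pl L}
  [MeasurableSpace (HLoc L v)] [BorelSpace (HLoc L v)] [MeasurableSpace (Gqs L v)] [BorelSpace (Gqs L v)]
  {νHv : Measure (HLoc L v)} {νQv : Measure (Gqs L v)} [νHv.IsHaarMeasure] [νHv.IsMulRightInvariant] [νQv.IsHaarMeasure] [νQv.IsMulRightInvariant]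
  [∀ a : HLoc L v, MeasurableSpace (HLoc L v ⧸ Subgroup.centralizer ({a} : Set (HLoc L v)))]
  [∀ a : HLoc L v, BorelSpace (HLoc L v ⧸ Subgroup.centralizer ({a} : Set (HLoc L v)))]
  [∀ γ : Gqs L v, MeasurableSpace (Gqs L v ⧸ Subgroup.centralizer ({γ} : Set (Gqs L v)))]
  [∀ γ : Gqs L v, BorelSpace (Gqs L v ⧸ Subgroup.centralizer ({γ} : Set (Gqs L v)))]
  {mHv : OrbitalMeasureFamily (HLoc L v)} {mQv : OrbitalMeasureFamily (Gqs L v)} {πSt : IrrClass (HLoc L v)}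
  [MeasurableSpace (H2 L).Adelic] [BorelSpace (H2 L).Adelic]
  [MeasurableSpace (GArch L)] [BorelSpace (GArch L)] [MeasurableSpace (HArch L)] [BorelSpace (HArch L)]
  [MeasurableSpace (H1Loc L v)] [MeasurableSpace (H1Arch L)] [MeasurableSpace (H1 L).Adelic] [BorelSpace (H1 L).Adelic]
  {𝔥 : S10HDatum L μ v νHv νQv mHv mQv πSt}

/-! ## §1 The finite part of the frozen test function, on `Πʳ_w [U(Φ₃)(L⁺_w), K_w]` and on `U(Φ₃)(𝔸_{L⁺,f})` -/

/-- **`𝔳.finLevelFun φ`** — the finite part `φ ⊗ 𝟙_{K^v}` of the frozen test function at the frozen levels: `g ↦ φ(g_v) · 𝟙{∀ w ≠ v, g_w ∈ K_w}` on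
`Πʳ_w [U(Φ₃)(L⁺_w), K_w]` — the integrand of ★ `S10MemberFlath.hsplit` ∕ ★ `S10GCutCore.hsplit` VERBATIM («`Tr π^∞(φ ⊗ 𝟙_{K^v})`»).
[cite: Rogawski1990, §13.8 p. 219 L1–L3] [cite: FlathCorvallis1979, §2 Example 2] -/
def S10Frozen.finLevelFun (𝔳 : S10Frozen L μ v νHv νQv mHv mQv πSt 𝔥) (φ : Gqs L v → ℂ) : (Πʳ w : Pl L, [Gqs L w, 𝔳.K w]) → ℂ :=
  fun g => φ (g v) * Set.indicator {g : Πʳ w : Pl L, [Gqs L w, 𝔳.K w] | ∀ w, w ≠ v → g w ∈ 𝔳.K w} (fun _ => (1 : ℂ)) g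

/-- Read-back of `finLevelFun` (`rfl`). [cite: Rogawski1990, §13.8 p. 219 L1–L3] -/
theorem S10Frozen.finLevelFun_apply (𝔳 : S10Frozen L μ v νHv νQv mHv mQv πSt 𝔥) (φ : Gqs L v → ℂ) (g : Πʳ w : Pl L, [Gqs L w, 𝔳.K w]) :
    𝔳.finLevelFun φ g = φ (g v) * Set.indicator {g : Πʳ w : Pl L, [Gqs L w, 𝔳.K w] | ∀ w, w ≠ v → g w ∈ 𝔳.K w} (fun _ => (1 : ℂ)) g := rfl

/-- **`𝔳.finAdelicFun φ = Λ_φ`** — the finite part READ ON `U(Φ₃)(𝔸_{L⁺,f})`: `Λ_φ := (φ ⊗ 𝟙_{K^v}) ∘ ẽ` with `ẽ = memberFinAdelicEquiv 𝔳` (★ p863660), i.e.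
`x ↦ φ((ẽ x)_v) · 𝟙{∀ w ≠ v, (ẽ x)_w ∈ K_w}` — the `Λ` of ★ `ArchFinSplitG3Letter` at the frozen vector. [cite: BorelJacquet1979, §4.1] [cite: Rogawski1990, §13.8 p. 219 L1–L3] -/
def S10Frozen.finAdelicFun (𝔳 : S10Frozen L μ v νHv νQv mHv mQv πSt 𝔥) (φ : Gqs L v → ℂ) :
    finAdelic (↥(maximalRealSubfield L)) L (IsCMField.complexConj L) 3 (qsForm L) → ℂ :=
  𝔳.finLevelFun φ ∘ memberFinAdelicEquiv 𝔳

/-- Read-back: `Λ_φ = finLevelFun ∘ ẽ` (`rfl`; the shape ★ `smoothTrace_comp_continuousMulEquiv` consumes). [cite: BorelJacquet1979, §4.1] -/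
theorem S10Frozen.finAdelicFun_eq_comp (𝔳 : S10Frozen L μ v νHv νQv mHv mQv πSt 𝔥) (φ : Gqs L v → ℂ) :
    𝔳.finAdelicFun φ = 𝔳.finLevelFun φ ∘ memberFinAdelicEquiv 𝔳 := rfl

/-- Read-back of `Λ_φ` pointwise (`rfl`). [cite: BorelJacquet1979, §4.1] -/
theorem S10Frozen.finAdelicFun_apply (𝔳 : S10Frozen L μ v νHv νQv mHv mQv πSt 𝔥) (φ : Gqs L v → ℂ)
    (x : finAdelic (↥(maximalRealSubfield L)) L (IsCMField.complexConj L) 3 (qsForm L)) :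
    𝔳.finAdelicFun φ x = φ (memberFinAdelicEquiv 𝔳 x v) *
      Set.indicator {g : Πʳ w : Pl L, [Gqs L w, 𝔳.K w] | ∀ w, w ≠ v → g w ∈ 𝔳.K w} (fun _ => (1 : ℂ)) (memberFinAdelicEquiv 𝔳 x) := rfl

/-! ## §2 The coordinate pin `(ẽ x_f)_w = x_w` and THE FACTORISATION `𝔳.ΦG φ = f_∞ ⊗ Λ_φ` -/

/-- **Coordinates of `ẽ` on finite parts**: `(ẽ (x_f))_w = x_w` — the `w`-component of the transported finite part of `x ∈ U(Φ₃)(𝔸_{L⁺})` IS the datum's local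
component `toLocal w x` (★ `memberFinAdelicEquiv_apply`; `evalPlace w = (finAdelicEquiv ·) w` definitionally; ★ `localPiEquiv_evalPlace_finPart`).
[cite: PlatonovRapinchuk1994, §5.1] [cite: BorelJacquet1979, §4.1] -/
theorem memberFinAdelicEquiv_finPart_apply (𝔳 : S10Frozen L μ v νHv νQv mHv mQv πSt 𝔥) (x : (G3 L).Adelic) (w : Pl L) :
    memberFinAdelicEquiv 𝔳 (UnitaryGroup.finPart (↥(maximalRealSubfield L)) L (IsCMField.complexConj L) 3 (qsForm L) x) w = (G3 L).toLocal w x := by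
  rw [memberFinAdelicEquiv_apply]
  exact localPiEquiv_evalPlace_finPart (↥(maximalRealSubfield L)) L (IsCMField.complexConj L) 3 (qsForm L) w x

/-- Almost every coordinate of the transported finite part `ẽ (x_f)` of `x ∈ U(Φ₃)(𝔸_{L⁺})` lies in the frozen level `K_w` (`K_w = U(Φ₃)(𝒪_w)` off `v`,
★ `S10Frozen.hKstd`; ★ `eventually_evalPlace_mem_localInt`, ★ `toLocal_mem_localIntegralLevel_iff`). [cite: BorelJacquet1979, §4.1] [cite: PlatonovRapinchuk1994, §5.1] -/
theorem S10Frozen.eventually_memberFinAdelicEquiv_finPart_mem (𝔳 : S10Frozen L μ v νHv νQv mHv mQv πSt 𝔥) (x : (G3 L).Adelic) :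
    ∀ᶠ w in cofinite, memberFinAdelicEquiv 𝔳 (UnitaryGroup.finPart (↥(maximalRealSubfield L)) L (IsCMField.complexConj L) 3 (qsForm L) x) w ∈
      (𝔳.K w : Set (Gqs L w)) := by
  filter_upwards [eventually_evalPlace_mem_localInt (↥(maximalRealSubfield L)) L (IsCMField.complexConj L) 3 (qsForm L)
      (UnitaryGroup.finPart (↥(maximalRealSubfield L)) L (IsCMField.complexConj L) 3 (qsForm L) x),
    (Set.finite_singleton v).compl_mem_cofinite] with w hw hwv
  have hwv' : w ≠ v := by simpa using hwv
  rw [memberFinAdelicEquiv_finPart_apply, 𝔳.hKstd w hwv']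
  exact (toLocal_mem_localIntegralLevel_iff (↥(maximalRealSubfield L)) L (IsCMField.complexConj L) 3 (qsForm L) w x).2 hw

/-- **THE ARCH–FIN FACTORISATION OF THE FROZEN TEST FUNCTION (junction J-6b, glue (i))**: for locally smooth `φ` and every `x ∈ U(Φ₃)(𝔸_{L⁺})`,
`𝔳.ΦG φ (x) = 𝔳.fGi (x_∞) · Λ_φ (x_f)` — ★ `S10Frozen.hΦG` («`f = f_∞ ⊗ φ ⊗ 𝟙_{K^v}`» pinned pointwise) with its coordinates read through `ẽ`
(`memberFinAdelicEquiv_finPart_apply`) and the unit `finprod` `∏ᶠ_{w ≠ v} 𝟙_{K_w}` rewritten as the box indicator (★ `finprod_subtype_indicator_eq_ite`; almost every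
coordinate is integral).  This is EXACTLY the product hypothesis `∀ x, F x = fi (archPart x) * Λ (finPart x)` of ★ `ArchFinSplitG3Letter` at `F := 𝔳.ΦG φ`, `fi := 𝔳.fGi`,
`Λ := 𝔳.finAdelicFun φ`. [cite: Rogawski1990, §13.8 p. 218 L24, p. 219 L2] [cite: BorelJacquet1979, §4.1] -/
theorem S10Frozen.ΦG_eq_fGi_mul_finAdelicFun (𝔳 : S10Frozen L μ v νHv νQv mHv mQv πSt 𝔥) {φ : Gqs L v → ℂ} (hφ : IsLocSmooth φ)
    (x : (G3 L).Adelic) :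
    𝔳.ΦG φ x = 𝔳.fGi (UnitaryGroup.archPart (↥(maximalRealSubfield L)) L (IsCMField.complexConj L) 3 (qsForm L) x) *
      𝔳.finAdelicFun φ (UnitaryGroup.finPart (↥(maximalRealSubfield L)) L (IsCMField.complexConj L) 3 (qsForm L) x) := by
  classical
  rw [𝔳.hΦG φ hφ x]
  congr 1
  -- read every local component `x_w` as the coordinate `(ẽ x_f)_w`
  simp only [← memberFinAdelicEquiv_finPart_apply 𝔳 x]
  rw [S10Frozen.finAdelicFun_apply]
  congr 1
  rw [finprod_subtype_indicator_eq_ite (R := fun w : Pl L => Gqs L w) (fun w => w ≠ v) (fun w => (𝔳.K w : Set (Gqs L w)))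
    (fun w => memberFinAdelicEquiv 𝔳 (UnitaryGroup.finPart (↥(maximalRealSubfield L)) L (IsCMField.complexConj L) 3 (qsForm L) x) w)
    (𝔳.eventually_memberFinAdelicEquiv_finPart_mem x)]
  by_cases hall : ∀ w, w ≠ v →
      memberFinAdelicEquiv 𝔳 (UnitaryGroup.finPart (↥(maximalRealSubfield L)) L (IsCMField.complexConj L) 3 (qsForm L) x) w ∈ (𝔳.K w : Set (Gqs L w))
  · rw [if_pos hall, Set.indicator_of_mem (show _ ∈ {g : Πʳ w : Pl L, [Gqs L w, 𝔳.K w] | ∀ w, w ≠ v → g w ∈ 𝔳.K w} from hall)]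
  · rw [if_neg hall, Set.indicator_of_notMem (show _ ∉ {g : Πʳ w : Pl L, [Gqs L w, 𝔳.K w] | ∀ w, w ≠ v → g w ∈ 𝔳.K w} from hall)]

/-! ## §3 The `K^v`-bi-invariance read-back and the test-function guards -/

/-- **`K₀ × ∏_{w ≠ v} K_w` is a LEVEL of `φ ⊗ 𝟙_{K^v}`** for every level `K₀ ≤ K_v` of `φ` (the `K^v`-bi-invariance read-back): ★ `isLevel_boxSubgroup_restrictedPureTensor`
at `S = {v}`, sides `update K v K₀` (compact open, `= K_w` off `v`). [cite: FlathCorvallis1979, §2 Example 2] [cite: Rogawski1990, §13.8 p. 219 L2] -/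
theorem S10Frozen.isLevel_boxSubgroup_finLevelFun (𝔳 : S10Frozen L μ v νHv νQv mHv mQv πSt 𝔥) {φ : Gqs L v → ℂ} {K₀ : Subgroup (Gqs L v)}
    (hK₀ : IsLevel K₀ φ) (hle : K₀ ≤ 𝔳.K v) :
    IsLevel (boxSubgroup (K := fun w => 𝔳.K w) (Function.update (fun w => 𝔳.K w) v K₀)) (𝔳.finLevelFun φ) := by
  have hKo : ∀ w, IsOpen (𝔳.K w : Set (Gqs L w)) := 𝔳.hKo.out
  refine isLevel_boxSubgroup_restrictedPureTensor (K := fun w => 𝔳.K w) {v} (Function.update (fun w => 𝔳.K w) v K₀)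
    (fun w => ?_) (fun w => ?_) (fun w hw => ?_) 𝔳.hKc
    (Function.update (fun w (_ : Gqs L w) => (1 : ℂ)) v φ) (fun i => ?_) (𝔳.finLevelFun φ) (fun g hg => ?_) (fun g hg => ?_)
  · -- open sides
    by_cases hw : w = v
    · subst hw; rw [Function.update_self]; exact hK₀.isOpen
    · rw [Function.update_of_ne hw]; exact hKo w
  · -- sides inside `K_w`
    by_cases hw : w = v
    · subst hw; rw [Function.update_self]; exact hle
    · rw [Function.update_of_ne hw]
  · -- `= K_w` off `v`
    rw [Function.update_of_ne (fun h => hw (Finset.mem_singleton.2 h))]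
  · -- the level at `v`
    obtain ⟨i, hi⟩ := i
    have hiv : i = v := Finset.mem_singleton.1 hi
    subst hiv
    simp only [Function.update_self]
    exact hK₀
  · -- on the box: `φ(g_v) · 1`
    have hmem : g ∈ {g : Πʳ w : Pl L, [Gqs L w, 𝔳.K w] | ∀ w, w ≠ v → g w ∈ 𝔳.K w} := by
      intro w hw
      have h := hg w (fun h => hw (Finset.mem_singleton.1 h))
      rwa [Function.update_of_ne hw] at h
    rw [S10Frozen.finLevelFun_apply, Set.indicator_of_mem hmem, mul_one,
      Finset.prod_coe_sort {v} (fun i => Function.update (fun w (_ : Gqs L w) => (1 : ℂ)) v φ i (g i)), Finset.prod_singleton,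
      Function.update_self]
  · -- off the box: `0`
    have hnot : g ∉ {g : Πʳ w : Pl L, [Gqs L w, 𝔳.K w] | ∀ w, w ≠ v → g w ∈ 𝔳.K w} := by
      intro h
      exact hg fun w hw => by
        have hwv : w ≠ v := fun h' => hw (Finset.mem_singleton.2 h')
        rw [Function.update_of_ne hwv]
        exact h w hwv
    rw [S10Frozen.finLevelFun_apply, Set.indicator_of_notMem hnot, mul_zero]

/-- **`φ ⊗ 𝟙_{K^v}` has compact support** for locally smooth `φ`: its support lies in the image of the compact `tsupport φ × ∏_w K_w` under the continuous map
`(t, k) ↦ ι_v(t) · k`. [cite: FlathCorvallis1979, §2 Example 2] [cite: BorelJacquet1979, §4.1] -/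
theorem S10Frozen.hasCompactSupport_finLevelFun (𝔳 : S10Frozen L μ v νHv νQv mHv mQv πSt 𝔥) {φ : Gqs L v → ℂ} (hφ : IsLocSmooth φ) :
    HasCompactSupport (𝔳.finLevelFun φ) := by
  haveI := 𝔳.hKo
  -- the compact set `ι_v(tsupport φ) · ∏_w K_w`
  let m : Gqs L v × (Πʳ w : Pl L, [Gqs L w, 𝔳.K w]) → Πʳ w : Pl L, [Gqs L w, 𝔳.K w] :=
    fun p => mulSingleHom (fun w => 𝔳.K w) v p.1 * p.2
  have hm : Continuous m := ((continuous_mulSingleHom (K := fun w => 𝔳.K w) v).comp continuous_fst).mul continuous_snd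
  have hbox : IsCompact (boxSubgroup (K := fun w => 𝔳.K w) (fun w => 𝔳.K w) : Set (Πʳ w : Pl L, [Gqs L w, 𝔳.K w])) :=
    isCompact_boxSubgroup (fun w => le_rfl) 𝔳.hKc
  have hC : IsCompact (m '' (tsupport φ ×ˢ (boxSubgroup (K := fun w => 𝔳.K w) (fun w => 𝔳.K w) : Set (Πʳ w : Pl L, [Gqs L w, 𝔳.K w])))) :=
    (hφ.hasCompactSupport.prod hbox).image hm
  refine HasCompactSupport.intro hC fun g hg => ?_
  -- off that set the function vanishes: otherwise `g = ι_v(g_v) · (ι_v(g_v)⁻¹ g)` exhibits `g` inside it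
  by_contra hne
  apply hg
  have hφg : φ (g v) ≠ 0 := fun h0 => hne (by rw [S10Frozen.finLevelFun_apply, h0, zero_mul])
  have hind : g ∈ {g : Πʳ w : Pl L, [Gqs L w, 𝔳.K w] | ∀ w, w ≠ v → g w ∈ 𝔳.K w} := by
    by_contra hn
    exact hne (by rw [S10Frozen.finLevelFun_apply, Set.indicator_of_notMem hn, mul_zero])
  refine ⟨(g v, (mulSingleHom (fun w => 𝔳.K w) v (g v))⁻¹ * g), ⟨subset_tsupport _ hφg, ?_⟩, ?_⟩
  · rw [SetLike.mem_coe, mem_boxSubgroup_iff]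
    intro w
    by_cases hw : w = v
    · subst hw
      rw [RestrictedProduct.mul_apply, RestrictedProduct.inv_apply, mulSingleHom_apply_apply, Pi.mulSingle_eq_same, inv_mul_cancel]
      exact (𝔳.K w).one_mem
    · rw [RestrictedProduct.mul_apply, RestrictedProduct.inv_apply, mulSingleHom_apply_apply, Pi.mulSingle_eq_of_ne hw, inv_one, one_mul]
      exact hind w hw
  · show mulSingleHom (fun w => 𝔳.K w) v (g v) * ((mulSingleHom (fun w => 𝔳.K w) v (g v))⁻¹ * g) = g
    rw [mul_inv_cancel_left]

/-- **`φ ⊗ 𝟙_{K^v} ∈ C_c^∞(Πʳ_w [U(Φ₃)(L⁺_w), K_w])`** for locally smooth `φ`: locally constant because it has a level (`isLevel_boxSubgroup_finLevelFun` at a level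
`K₀ ∩ K_v` of `φ`, ★ `exists_isLevel`, ★ `IsLevel.isLocallyConstant`), compactly supported by `hasCompactSupport_finLevelFun`.
[cite: FlathCorvallis1979, §2 Example 2] [cite: Rogawski1990, §1.6 p. 6] -/
theorem S10Frozen.isLocSmooth_finLevelFun (𝔳 : S10Frozen L μ v νHv νQv mHv mQv πSt 𝔥) {φ : Gqs L v → ℂ} (hφ : IsLocSmooth φ) :
    IsLocSmooth (𝔳.finLevelFun φ) := by
  haveI := 𝔳.hKo
  haveI : NonarchimedeanGroup (Gqs L v) :=
    nonarchimedeanGroup_unitaryGroupOfForm_local (E := L) (c := IsCMField.complexConj L) (N := 3) (v := v)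
      (J' := (adelicForm L 3 (qsForm L)).map (adeleToLocal L v))
  haveI : LocallyCompactSpace (Gqs L v) := locallyCompactSpace_local (IsCMField.complexConj L) 3 _ v
  obtain ⟨K₀, hK₀⟩ := exists_isLevel (G := Gqs L v) (f := φ) hφ
  have hKvo : IsOpen (𝔳.K v : Set (Gqs L v)) := 𝔳.hKo.out v
  have hio : IsOpen ((K₀ ⊓ 𝔳.K v : Subgroup (Gqs L v)) : Set (Gqs L v)) := by
    rw [Subgroup.coe_inf]; exact hK₀.isOpen.inter hKvo
  have hic : IsCompact ((K₀ ⊓ 𝔳.K v : Subgroup (Gqs L v)) : Set (Gqs L v)) :=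
    (𝔳.hKc v).of_isClosed_subset ((K₀ ⊓ 𝔳.K v).isClosed_of_isOpen hio) (by rw [Subgroup.coe_inf]; exact Set.inter_subset_right)
  have hlev := 𝔳.isLevel_boxSubgroup_finLevelFun (hK₀.mono inf_le_left hio hic) inf_le_right
  exact ⟨hlev.isLocallyConstant, 𝔳.hasCompactSupport_finLevelFun hφ⟩

/-- **`Λ_φ ∈ C_c^∞(U(Φ₃)(𝔸_{L⁺,f}))`** — the guard `IsLocSmooth Λ` of ★ `ArchFinSplitG3Letter` at the frozen vector: transport of `isLocSmooth_finLevelFun` along the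
homeomorphism `ẽ`. [cite: BorelJacquet1979, §4.1] [cite: Rogawski1990, §1.6 p. 6] -/
theorem S10Frozen.isLocSmooth_finAdelicFun (𝔳 : S10Frozen L μ v νHv νQv mHv mQv πSt 𝔥) {φ : Gqs L v → ℂ} (hφ : IsLocSmooth φ) :
    IsLocSmooth (𝔳.finAdelicFun φ) :=
  ⟨(𝔳.isLocSmooth_finLevelFun hφ).isLocallyConstant.comp_continuous (memberFinAdelicEquiv 𝔳).continuous,
    (𝔳.isLocSmooth_finLevelFun hφ).hasCompactSupport.comp_homeomorph (memberFinAdelicEquiv 𝔳).toHomeomorph⟩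

/-- **The transported level**: `ẽ⁻¹(K₀ × ∏_{w ≠ v} K_w)` is a level of `Λ_φ` on `U(Φ₃)(𝔸_{L⁺,f})` for every level `K₀ ≤ K_v` of `φ` (the `K^v`-bi-invariance read on the
finite-adelic group). [cite: FlathCorvallis1979, §2 Example 2] [cite: BorelJacquet1979, §4.1] -/
theorem S10Frozen.isLevel_comap_finAdelicFun (𝔳 : S10Frozen L μ v νHv νQv mHv mQv πSt 𝔥) {φ : Gqs L v → ℂ} {K₀ : Subgroup (Gqs L v)}
    (hK₀ : IsLevel K₀ φ) (hle : K₀ ≤ 𝔳.K v) :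
    IsLevel ((boxSubgroup (K := fun w => 𝔳.K w) (Function.update (fun w => 𝔳.K w) v K₀)).comap
      ((memberFinAdelicEquiv 𝔳 : finAdelic (↥(maximalRealSubfield L)) L (IsCMField.complexConj L) 3 (qsForm L) ≃ₜ* (Πʳ w : Pl L, [Gqs L w, 𝔳.K w])) :
        finAdelic (↥(maximalRealSubfield L)) L (IsCMField.complexConj L) 3 (qsForm L) →* (Πʳ w : Pl L, [Gqs L w, 𝔳.K w])))
      (𝔳.finAdelicFun φ) := by
  have h := 𝔳.isLevel_boxSubgroup_finLevelFun hK₀ hle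
  set e := memberFinAdelicEquiv 𝔳 with he
  refine ⟨?_, ?_, fun k hk x => ?_, fun k hk x => ?_⟩
  · rw [Subgroup.coe_comap]
    exact h.isOpen.preimage e.continuous
  · rw [Subgroup.coe_comap]
    exact e.toHomeomorph.isCompact_preimage.2 h.isCompact
  · show 𝔳.finLevelFun φ (e (x * k)) = 𝔳.finLevelFun φ (e x)
    rw [map_mul]
    exact h.mul_right (e k) hk (e x)
  · show 𝔳.finLevelFun φ (e (k * x)) = 𝔳.finLevelFun φ (e x)
    rw [map_mul]
    exact h.mul_left (e k) hk (e x)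

end Glue

end Summit.HodgeConjecture.HodgeConjecture.R90.S10

end
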